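import Mathlib
import HarnessLib
import Literature.MathematicalPhysics.KineticTheory.VelocityFlipNoise
import Literature.MathematicalPhysics.KineticTheory.VelocityFlipEmbeddedChainSteadyState
import Summits.AtomisticToContinuum.FouriersLaw.Theorems.VanishingNoiseTransferVanishingNoiseBoundFlipResolventTransposeMeasurable
import Summits.AtomisticToContinuum.FouriersLaw.Theorems.VanishingNoiseTransferVanishingNoiseBoundFlipWeakToClassical
import Summits.AtomisticToContinuum.FouriersLaw.Theorems.JunctionLocalitySuperadditiveResistanceDeviceGibbs

/-!
# Mild forward fields of the flip-noisy chain are distributional solutions (dual Kubo road: stub MILD)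

`--supports stmt-AtomisticToContinuum-11976` stub file (crux `VanishingNoiseBound`, route `VanishingNoiseTransfer`,
line `fekete-usc-one-length`, stub MILD `stub_flipMildDistributional`, wave 5).

For the pinned chain (all parameters `> 0`), `L ≥ 2`, a reference temperature `T > 0`, bath temperatures
`T_L, T_R > 0` with `1/(4T) < 1/max(T_L,T_R)`, a flip rate `ε > 0`, a constant `c` and a measurable `g` with
`|g| ≤ C e^{H/(4T)}` solving the centred MILD Poisson equation `g = R_{Lε}((Lε)⁻¹(p_0² − T − c) + Q g)` pointwise
(`R_r` the resolvent kernel of the flip-free Langevin dynamics at `(T_L, T_R)`, `Q g = L⁻¹ Σ_i g ∘ F_i` the flip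
average), `g` solves `(L_{T_L,T_R} + εS) g = −(p_0² − T) + c` in `𝓓'`, in the Lebesgue-transposed form
`∫ g · (−Lφ + 2γ(T_L ∂²_{p_0}φ + T_R ∂²_{p_{L−1}}φ) + 2γφ + εSφ) dx = ∫ (−(p_0² − T) + c) φ dx` (`φ ∈ C_c^∞`).

Proof: the transposed resolvent identity for measurable `e^{θH}`-bounded data
`∫ (R_r h)(rφ − ᵀLφ) dx = r ∫ φ h dx` (`pinnedChain_integral_resolvent_mul_transpose`, `θ = 1/(4T)`) with
`h = (Lε)⁻¹(p_0² − T − c) + Q g`, `r = Lε`, `R_r h = g`; the bridge `ᵀLφ = −Lφ + 2γ(T_L∂²_{p_0} + T_R∂²_{p_{L−1}})φ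
+ 2γφ` (`revGenerator_eq_neg_generator_add'`); and the sitewise Lebesgue symmetry of the flips
`∫ g · (φ ∘ F_i) dx = ∫ (g ∘ F_i) · φ dx` (`integral_mul_comp_momentumFlip`, `measurePreserving_momentumFlip_volume`),
which makes the `Q g`-part of `r ∫ φ h` cancel against `ε ∫ g Sφ + r ∫ g φ`.

* `integrable_mul_of_hasCompactSupport_of_abs_le` (`'`) — `u · v ∈ L¹(dx)` (`v · u ∈ L¹(dx)`) for `u ∈ C_c`, `v` measurable with
  `|v| ≤ Bd`, `Bd` continuous.
* `pinnedChain_abs_sq_momentum_sub_sub_le_exp` — `|p_i² − T − c| ≤ (2/θ + T + |c|) e^{θH}`.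
* `stub_flipMildDistributional` — the registered stub MILD.

References: Ethier–Kurtz 1986 Ch. 1 §2 (resolvent / mild Poisson equation); Bernardin–Olla 2011 §2.1 (`S` symmetric).
-/

noncomputable section

open MeasureTheory ProbabilityTheory Filter Topology Set
open scoped ContDiff NNReal ENNReal
open Literature.MathematicalPhysics.KineticTheory.HeatConduction
open Literature.MathematicalPhysics.KineticTheory Literature.Probability.Process OscillatorChain

namespace Summit.AtomisticToContinuum.FouriersLaw.Theorems.VanishingNoiseBound

variable {N : ℕ}

/-- **Products of compactly supported continuous functions with locally bounded measurable ones are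
Lebesgue integrable**: `u ∈ C_c`, `v` measurable with `|v| ≤ Bd`, `Bd` continuous, give `u · v ∈ L¹(dx)`. -/
theorem integrable_mul_of_hasCompactSupport_of_abs_le {u v Bd : PhaseSpace N → ℝ} (hu : Continuous u)
    (hus : HasCompactSupport u) (hv : Measurable v) (hBd : Continuous Bd) (hvb : ∀ x, |v x| ≤ Bd x) :
    Integrable (fun x => u x * v x) := by
  -- adapted from the local `hprod` of `pinnedChain_integral_resolvent_mul_transpose`
  have hdom : Integrable (fun x => ‖u x‖ * Bd x) :=
    (hu.norm.mul hBd).integrable_of_hasCompactSupport hus.norm.mul_right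
  refine hdom.mono' (hu.aestronglyMeasurable.mul hv.aestronglyMeasurable) (ae_of_all _ fun x => ?_)
  rw [norm_mul, Real.norm_eq_abs, Real.norm_eq_abs (v x)]
  exact mul_le_mul_of_nonneg_left (hvb x) (abs_nonneg _)

/-- The commuted form of `integrable_mul_of_hasCompactSupport_of_abs_le`: `v · u ∈ L¹(dx)`. -/
theorem integrable_mul_of_hasCompactSupport_of_abs_le' {u v Bd : PhaseSpace N → ℝ} (hu : Continuous u)
    (hus : HasCompactSupport u) (hv : Measurable v) (hBd : Continuous Bd) (hvb : ∀ x, |v x| ≤ Bd x) :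
    Integrable (fun x => v x * u x) :=
  (integrable_mul_of_hasCompactSupport_of_abs_le hu hus hv hBd hvb).congr (ae_of_all _ fun _ => mul_comm _ _)

/-- `|p_i² − T − c| ≤ (2/θ + T + |c|) e^{θH}` for the pinned chain with `ω₂, lam, β ≥ 0`, `θ > 0`, `T ≥ 0`
(`p_i² ≤ 2H`, `θH ≤ e^{θH}`, `1 ≤ e^{θH}`). -/
theorem pinnedChain_abs_sq_momentum_sub_sub_le_exp {ω₂ lam β : ℝ} (hω : 0 ≤ ω₂) (hl : 0 ≤ lam) (hβ : 0 ≤ β)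
    (γ : ℝ) {θ T : ℝ} (hθ : 0 < θ) (hT : 0 ≤ T) (c : ℝ) (z : PhaseSpace N) (i : Fin N) :
    |z.2 i ^ 2 - T - c| ≤ (2 / θ + T + |c|) * Real.exp (θ * (pinnedChain ω₂ lam β γ).hamiltonian N z) := by
  -- adapted from `Theorems.SubdiffusiveBondHeat.abs_sq_momentum_sub_le_exp`
  set Hz := (pinnedChain ω₂ lam β γ).hamiltonian N z
  have hH := pinnedChain_harmonic_le_hamiltonian (ω₂ := ω₂) hl hβ γ N z
  have h1 : 0 ≤ ∑ j, ω₂ * z.1 j ^ 2 / 2 := Finset.sum_nonneg fun j _ => by positivity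
  have h2 : z.2 i ^ 2 / 2 ≤ ∑ j, z.2 j ^ 2 / 2 :=
    Finset.single_le_sum (f := fun j => z.2 j ^ 2 / 2) (fun j _ => by positivity) (Finset.mem_univ _)
  have hp : z.2 i ^ 2 ≤ 2 * Hz := by linarith
  have hH0 : 0 ≤ Hz := by nlinarith [sq_nonneg (z.2 i)]
  have hexp : θ * Hz + 1 ≤ Real.exp (θ * Hz) := Real.add_one_le_exp _
  have hE1 : 1 ≤ Real.exp (θ * Hz) := Real.one_le_exp (by positivity)
  have hHle : Hz ≤ Real.exp (θ * Hz) / θ := by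
    rw [le_div_iff₀ hθ]; nlinarith
  have hc0 : 0 ≤ |c| := abs_nonneg c
  have habs : |z.2 i ^ 2 - T - c| ≤ z.2 i ^ 2 + T + |c| := by
    rw [abs_le]; constructor <;> nlinarith [sq_nonneg (z.2 i), le_abs_self c, neg_abs_le c]
  calc |z.2 i ^ 2 - T - c| ≤ 2 * Hz + T + |c| := by linarith
    _ ≤ 2 * (Real.exp (θ * Hz) / θ) + T * Real.exp (θ * Hz) + |c| * Real.exp (θ * Hz) := by nlinarith
    _ = (2 / θ + T + |c|) * Real.exp (θ * Hz) := by ring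

/-- **Stub MILD · flipMildDistributional — mild forward fields are distributional solutions.** See the module
docstring: a measurable `e^{H/(4T)}`-bounded solution `g` of the centred mild Poisson equation
`g = R_{Lε}((Lε)⁻¹(p_0² − T − c) + Q g)` solves `(L_{T_L,T_R} + εS) g = −(p_0² − T) + c` in the Lebesgue-transposed
weak form against every `φ ∈ C_c^∞`. -/
theorem stub_flipMildDistributional :
    ∀ (ω₂ lam β γ : ℝ) (hω : 0 < ω₂) (hl : 0 < lam) (hβ : 0 < β) (hγ : 0 < γ) (L : ℕ) (hL : 2 ≤ L)
      (T T_L T_R : ℝ) (hT : 0 < T) (hTL : 0 < T_L) (hTR : 0 < T_R), 1 / (4 * T) < 1 / max T_L T_R →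
      ∀ (ε : ℝ), 0 < ε → ∀ (c : ℝ) (g : PhaseSpace L → ℝ), Measurable g →
      (∃ C : ℝ, ∀ z, |g z| ≤ C * Real.exp (1 / (4 * T) * (pinnedChain ω₂ lam β γ).hamiltonian L z)) →
      (∀ z, g z = ∫ y, (((L : ℝ) * ε)⁻¹ * ((y.2 ⟨0, by omega⟩ ^ 2 - T) - c) +
          (L : ℝ)⁻¹ * ∑ i : Fin L, g (momentumFlip i y))
        ∂((pinnedChainSemigroup hω hl.le hβ.le hγ.le (by omega) hTL.le hTR.le).resolventKernel
          ((L : ℝ) * ε) z)) →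
      ∀ φ : PhaseSpace L → ℝ, ContDiff ℝ ((⊤ : ℕ∞) : WithTop ℕ∞) φ → HasCompactSupport φ →
        ∫ x, g x * (-((pinnedChain ω₂ lam β γ).generator L T_L T_R φ x) +
            2 * γ * (T_L * partialP (⟨0, by omega⟩ : Fin L) (partialP (⟨0, by omega⟩ : Fin L) φ) x +
              T_R * partialP (⟨L - 1, by omega⟩ : Fin L) (partialP (⟨L - 1, by omega⟩ : Fin L) φ) x) +
            2 * γ * φ x + ε * flipNoise L φ x) =
          ∫ x, (-(Theorems.SuperadditiveResistance.DeviceLiouville.kin L 0 x - T) + c) * φ x := by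
  intro ω₂ lam β γ hω hl hβ hγ L hL T T_L T_R hT hTL hTR h4T ε hε c g hgm hgb hmild φ hφ hφc
  obtain ⟨C, hC⟩ := hgb
  have hL1 : 1 < L := by omega
  have hL0 : 0 < L := Nat.zero_lt_of_lt hL1
  have hLr : (0 : ℝ) < L := by exact_mod_cast hL0
  have hLne : (L : ℝ) ≠ 0 := hLr.ne'
  set P := pinnedChain ω₂ lam β γ with hPdef
  set θ : ℝ := 1 / (4 * T) with hθdef
  have hθ : 0 < θ := by positivity
  set r : ℝ := (L : ℝ) * ε with hrdef
  have hr : 0 < r := by positivity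
  have hHc : Continuous (P.hamiltonian L) := pinnedChain_continuous_hamiltonian ω₂ lam β γ L
  have hγ' : P.γ = γ := rfl
  have hφc' : Continuous φ := hφ.continuous
  have hφ2 : ContDiff ℝ 2 φ := hφ.of_le (by norm_cast)
  have hU : ContDiff ℝ ∞ P.U := pinnedChain_contDiff_U ω₂ lam β γ
  have hV : ContDiff ℝ ∞ P.V := pinnedChain_contDiff_V ω₂ lam β γ
  -- the datum `h = r⁻¹ (p_0² − T − c) + Q g` of the mild equation: measurable and `e^{θH}`-bounded
  set A : PhaseSpace L → ℝ := fun y => y.2 ⟨0, hL0⟩ ^ 2 - T - c with hAdef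
  set h : PhaseSpace L → ℝ := fun y => r⁻¹ * A y + (L : ℝ)⁻¹ * ∑ i : Fin L, g (momentumFlip i y)
    with hhdef
  have hAc : Continuous A := by rw [hAdef]; fun_prop
  have hgFm : ∀ i : Fin L, Measurable fun y => g (momentumFlip i y) := fun i => hgm.comp (measurable_momentumFlip i)
  have hhm : Measurable h := by
    rw [hhdef]
    exact (hAc.measurable.const_mul _).add ((Finset.measurable_sum _ fun i _ => hgFm i).const_mul _)
  have hgFb : ∀ (i : Fin L) (y : PhaseSpace L), |g (momentumFlip i y)| ≤ C * Real.exp (θ * P.hamiltonian L y) := by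
    intro i y
    have h1 := hC (momentumFlip i y)
    rwa [P.hamiltonian_momentumFlip] at h1
  have hAb : ∀ y, |A y| ≤ (2 / θ + T + |c|) * Real.exp (θ * P.hamiltonian L y) := fun y =>
    pinnedChain_abs_sq_momentum_sub_sub_le_exp hω.le hl.le hβ.le γ hθ hT.le c y ⟨0, hL0⟩
  set C' : ℝ := r⁻¹ * (2 / θ + T + |c|) + (L : ℝ)⁻¹ * (L * C) with hC'def
  have hhb : ∀ y, |h y| ≤ C' * Real.exp (θ * P.hamiltonian L y) := by
    intro y
    have hsum : |∑ i : Fin L, g (momentumFlip i y)| ≤ L * (C * Real.exp (θ * P.hamiltonian L y)) := by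
      calc |∑ i : Fin L, g (momentumFlip i y)| ≤ ∑ i : Fin L, |g (momentumFlip i y)| :=
            Finset.abs_sum_le_sum_abs _ _
        _ ≤ ∑ _i : Fin L, C * Real.exp (θ * P.hamiltonian L y) := Finset.sum_le_sum fun i _ => hgFb i y
        _ = L * (C * Real.exp (θ * P.hamiltonian L y)) := by
            rw [Finset.sum_const, Finset.card_univ, Fintype.card_fin, nsmul_eq_mul]
    calc |h y| = |r⁻¹ * A y + (L : ℝ)⁻¹ * ∑ i : Fin L, g (momentumFlip i y)| := rfl
      _ ≤ |r⁻¹ * A y| + |(L : ℝ)⁻¹ * ∑ i : Fin L, g (momentumFlip i y)| := abs_add_le _ _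
      _ = r⁻¹ * |A y| + (L : ℝ)⁻¹ * |∑ i : Fin L, g (momentumFlip i y)| := by
            rw [abs_mul, abs_mul, abs_of_pos (inv_pos.2 hr), abs_of_pos (inv_pos.2 hLr)]
      _ ≤ r⁻¹ * ((2 / θ + T + |c|) * Real.exp (θ * P.hamiltonian L y)) +
            (L : ℝ)⁻¹ * (L * (C * Real.exp (θ * P.hamiltonian L y))) :=
            add_le_add (mul_le_mul_of_nonneg_left (hAb y) (inv_pos.2 hr).le)
              (mul_le_mul_of_nonneg_left hsum (inv_pos.2 hLr).le)
      _ = C' * Real.exp (θ * P.hamiltonian L y) := by rw [hC'def]; ring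
  -- (1) the transposed resolvent identity `∫ (R_r h)(rφ − ᵀLφ) dx = r ∫ φ h dx`, with `R_r h = g`
  have hA := pinnedChain_integral_resolvent_mul_transpose hω hl hβ hγ hL1 hTL hTR hr hθ h4T hφ hφc hhm hhb
  have hRh : ∀ x, ∫ y, h y ∂((pinnedChainSemigroup hω hl.le hβ.le hγ.le (Nat.zero_lt_of_lt hL1) hTL.le
      hTR.le).resolventKernel r x) = g x := fun x => (hmild x).symm
  set W : PhaseSpace L → ℝ := fun x => r * φ x - (sdeGenerator (fun y => -P.drift L y) (P.bathVecL L T_L)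
    (P.bathVecR L T_R) φ x + 2 * γ * φ x) with hWdef
  have hgW : ∫ x, g x * W x = r * ∫ x, φ x * h x := by
    rw [← hA]
    refine integral_congr_ae (ae_of_all _ fun x => ?_)
    dsimp only
    rw [hRh x]
  -- (2) continuity / support / integrability bookkeeping
  have hWc : Continuous W := by
    rw [hWdef]
    exact (continuous_const.mul hφc').sub
      ((continuous_sdeGenerator _ _ (P.contDiff_drift hU hV L).continuous.neg hφ2).add
        (continuous_const.mul hφc'))
  have hWs : HasCompactSupport W := by
    rw [hWdef]
    exact hφc.mul_left.sub ((hasCompactSupport_sdeGenerator _ _ hφc).add hφc.mul_left)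
  have hφFc : ∀ i : Fin L, Continuous fun x => φ (momentumFlip i x) := fun i =>
    hφc'.comp (continuous_momentumFlip i)
  have hφFs : ∀ i : Fin L, HasCompactSupport fun x => φ (momentumFlip i x) := by
    intro i
    let e : PhaseSpace L ≃ₜ PhaseSpace L :=
      { toFun := momentumFlip i, invFun := momentumFlip i, left_inv := momentumFlip_momentumFlip i,
        right_inv := momentumFlip_momentumFlip i, continuous_toFun := continuous_momentumFlip i,
        continuous_invFun := continuous_momentumFlip i }
    exact hφc.comp_homeomorph e
  have hEc : Continuous fun x => C * Real.exp (θ * P.hamiltonian L x) := by fun_prop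
  have hgb' : ∀ x, |g x| ≤ C * Real.exp (θ * P.hamiltonian L x) := hC
  have iW : Integrable fun x => g x * W x := integrable_mul_of_hasCompactSupport_of_abs_le' hWc hWs hgm hEc hgb'
  have igF : ∀ i : Fin L, Integrable fun x => g x * φ (momentumFlip i x) := fun i =>
    integrable_mul_of_hasCompactSupport_of_abs_le' (hφFc i) (hφFs i) hgm hEc hgb'
  have iFg : ∀ i : Fin L, Integrable fun x => g (momentumFlip i x) * φ x := fun i =>
    integrable_mul_of_hasCompactSupport_of_abs_le' hφc' hφc (hgFm i) hEc (hgFb i)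
  have iφA : Integrable fun x => φ x * A x := (hφc'.mul hAc).integrable_of_hasCompactSupport hφc.mul_right
  -- (3) the flip symmetry, sitewise: `∫ g · (φ ∘ F_i) dx = ∫ (g ∘ F_i) · φ dx`
  have hflip : ∀ i : Fin L, ∫ x, g x * φ (momentumFlip i x) = ∫ x, g (momentumFlip i x) * φ x := fun i =>
    integral_mul_comp_momentumFlip (measurePreserving_momentumFlip_volume i) φ g
  set Y : ℝ := ∑ i : Fin L, ∫ x, g (momentumFlip i x) * φ x with hYdef
  set X : ℝ := ∫ x, φ x * A x with hXdef
  -- (4) `∫ φ h dx = r⁻¹ X + L⁻¹ Y` (so that `r ∫ φ h dx = X + ε Y`)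
  have hφh : ∫ x, φ x * h x = r⁻¹ * X + (L : ℝ)⁻¹ * Y := by
    have e1 : ∀ x, φ x * h x =
        r⁻¹ * (φ x * A x) + (L : ℝ)⁻¹ * ∑ i : Fin L, g (momentumFlip i x) * φ x := by
      intro x
      rw [← Finset.sum_mul]
      simp only [hhdef]
      ring
    rw [integral_congr_ae (ae_of_all _ e1), integral_add (iφA.const_mul _)
      ((integrable_finsetSum _ fun i _ => iFg i).const_mul _), integral_const_mul, integral_const_mul,
      integral_finsetSum _ fun i _ => iFg i]
  -- (5) the pointwise form of the weak-form integrand: `g ᵀL_εφ = −g W + ε Σ_i g (φ ∘ F_i)`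
  have hpt : ∀ x, g x * (-(P.generator L T_L T_R φ x) +
      2 * γ * (T_L * partialP (⟨0, hL0⟩ : Fin L) (partialP (⟨0, hL0⟩ : Fin L) φ) x +
        T_R * partialP (⟨L - 1, Nat.sub_lt hL0 one_pos⟩ : Fin L)
          (partialP (⟨L - 1, Nat.sub_lt hL0 one_pos⟩ : Fin L) φ) x) +
      2 * γ * φ x + ε * flipNoise L φ x) =
      -(g x * W x) + ε * ∑ i : Fin L, g x * φ (momentumFlip i x) := by
    intro x
    have hb := revGenerator_eq_neg_generator_add' P hL0 (T_L := T_L) (T_R := T_R)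
      (by rw [hγ']; positivity) (by rw [hγ']; positivity) hφ2 x
    rw [hγ'] at hb
    have hS : flipNoise L φ x = (∑ i : Fin L, φ (momentumFlip i x)) - L * φ x := by
      rw [flipNoise_eq, Finset.sum_sub_distrib, Finset.sum_const, Finset.card_univ, Fintype.card_fin,
        nsmul_eq_mul]
    rw [hS, ← Finset.mul_sum, hWdef, hrdef]
    linear_combination (-(g x)) * hb
  -- (6) assemble
  have hr1 : r * r⁻¹ = 1 := mul_inv_cancel₀ hr.ne'
  have hr2 : r * (L : ℝ)⁻¹ = ε := by rw [hrdef]; field_simp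
  have hkin : ∀ x : PhaseSpace L, (-(Theorems.SuperadditiveResistance.DeviceLiouville.kin L 0 x - T) + c) * φ x =
      -(φ x * A x) := by
    intro x
    rw [Theorems.SuperadditiveResistance.DeviceLiouville.kin_eq_sq hL0, hAdef]
    ring
  calc ∫ x, g x * (-(P.generator L T_L T_R φ x) +
        2 * γ * (T_L * partialP (⟨0, hL0⟩ : Fin L) (partialP (⟨0, hL0⟩ : Fin L) φ) x +
          T_R * partialP (⟨L - 1, Nat.sub_lt hL0 one_pos⟩ : Fin L)
            (partialP (⟨L - 1, Nat.sub_lt hL0 one_pos⟩ : Fin L) φ) x) +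
        2 * γ * φ x + ε * flipNoise L φ x)
      = ∫ x, (-(g x * W x) + ε * ∑ i : Fin L, g x * φ (momentumFlip i x)) :=
        integral_congr_ae (ae_of_all _ hpt)
    _ = -(∫ x, g x * W x) + ε * ∑ i : Fin L, ∫ x, g x * φ (momentumFlip i x) := by
        rw [integral_add iW.fun_neg ((integrable_finsetSum _ fun i _ => igF i).const_mul ε), integral_neg,
          integral_const_mul, integral_finsetSum _ fun i _ => igF i]
    _ = -(r * (r⁻¹ * X + (L : ℝ)⁻¹ * Y)) + ε * Y := by
        rw [hgW, hφh, hYdef]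
        simp only [hflip]
    _ = -X := by
        rw [mul_add, ← mul_assoc, ← mul_assoc, hr1, hr2]; ring
    _ = ∫ x, (-(Theorems.SuperadditiveResistance.DeviceLiouville.kin L 0 x - T) + c) * φ x := by
        rw [hXdef, ← integral_neg]
        exact integral_congr_ae (ae_of_all _ fun x => (hkin x).symm)

end Summit.AtomisticToContinuum.FouriersLaw.Theorems.VanishingNoiseBound

end
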